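import Literature.MathematicalPhysics.QuantumFieldTheory.Balaban1983to89.B1Eq324BenfattoLemma
import HarnessLib

/-!
# `Balaban1983to89.B1Eq324BenfattoConnLength` — [BenfattoEtAl1978] p. 151 «d(Δ₁, …, Δ_p) is the length of the smallest path connecting
# Δ₁ … Δ_p»: the first API of p463705's `connLength` (the decay length of the Hamiltonians (4.1)/(4.5)/(5.5)) and the lattice sums of
# `e^{−c·d(Δ, Δ′)}` — the geometric input of §5 (5.11) «terms reaching across a corridor are O(e^{−(ϰ/4)b^{3/2}})»

statement-level skeleton of published theorems with citation tags; proofs where landed; nothing here is a claim about the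
Yang–Mills mass gap

WHY THIS MODULE (cell `pub-ymgap`, seat `dag-n08-d` gen 8, INTENT-19; node N08 [Balaban1985UV3]; the [BenfattoEtAl1978] source chain behind
the (α)-row `h324c`).  Every «the error has the same form» step of §5 of [BenfattoEtAl1978] ((5.11), (5.24), (5.29), (5.34), App. D) rests on
two facts about the decay factor `e^{−(ϰ/2)d(Δ₁…Δ_p)}` of the Hamiltonians: a tuple of tesserae touching two regions at lattice distance `ℓ`
has `d(Δ₁…Δ_p) ≥ ℓ`, and `Σ_{Δ′} e^{−c·d(Δ, Δ′)}` is bounded uniformly in the region summed over.  p463705 typed `d(Δ₁…Δ_p)` literally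
(`connLength` = the infimum of the lengths of the polygonal paths visiting the cubes in some order) with no API; this file supplies it.

WHAT IS PROVED (no definition, no named fact, no `sorry`; axioms standard):
* §1 `segLength_eq_dist` (the tree's `segLength u v` IS the Euclidean distance of `R^d`), `segLength_comm`, `segLength_nonneg`,
  `segLength_self`, `segLength_triangle`.
* §2 `polyLength_zero'`/`polyLength_one'` (degenerate polygons), ★ `polyLength_succ_succ` (peel the first segment:
  `polyLength y = |y₀ − y₁| + polyLength (y ∘ succ)`), `polyLength_nonneg`, ★ `segLength_zero_le_polyLength` and
  ★ `segLength_le_polyLength` (any two vertices of a polygonal path are no farther apart than its length).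
* §3 `abs_sub_sub_one_le_of_mem_interval` / ★ `cubeDist_le_segLength` (points of the closed unit cubes `Δ_x`, `Δ_y` are at least
  `cubeDist x y` apart — `cubeDist` IS the distance of the cubes), `cubeDist_comm`, `corner_mem_unitCube` (`cubeDist_nonneg` is
  n08-b's `B1Eq324BenfattoAppendixA.cubeDist_nonneg`, not restated).
* §4 ★ `connLength_nonneg`, ★★ `cubeDist_le_connLength` (`cubeDist (Δ a) (Δ b) ≤ connLength Δ` for all indices `a, b` — the
  connecting path passes through both cubes), ★ `exp_neg_mul_connLength_le_prod` (`e^{−c·d(Δ)} ≤ Π_{i} e^{−(c/p)·cubeDist(Δ a, Δ i)}`: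
  the decay factor of a `p`-tuple is dominated by the product of two-body decays from any anchor `Δ a`).
* §5 lattice sums: private `sum_pow_natAbs_le` (1-d geometric sum over any finite `S ⊂ ℤ`), ★ `sum_gap_le_sqrt_mul_cubeDist`
  (`‖gap‖₁ ≤ √d·‖gap‖₂`),
  ★★ `sum_exp_neg_mul_cubeDist_le` (`Σ_{y∈F} e^{−c·cubeDist x y} ≤ K(c, d)` for EVERY finite `F ⊂ ℤ^d`, explicit `K`).
HONEST SCOPE.  Geometry/combinatorics of the printed decay length only; (5.11) itself is the next module.  count-neutral for N08;
`BasicLemmaPrinted` NOT discharged; nothing about d = 4, the continuum, OS axioms, a mass gap or the Clay problem.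
-/

noncomputable section

open Finset
open scoped BigOperators

namespace Literature.MathematicalPhysics.QuantumFieldTheory.Balaban1983to89.B1Eq324BenfattoConnLength

open Literature.MathematicalPhysics.QuantumFieldTheory.Balaban1983to89.B3Sect3VectorSelfEnergy
open Literature.MathematicalPhysics.QuantumFieldTheory.Balaban1983to89.B1Eq324BenfattoLemma

variable {d : ℕ}

/-! ## §1  `segLength` is the Euclidean distance -/

/-- **The tree's segment length IS the Euclidean distance of `R^d`.** [cite: BenfattoEtAl1978, after (4.1) p.151] -/
theorem segLength_eq_dist (u v : Fin d → ℝ) :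
    segLength u v = dist (WithLp.toLp 2 u : EuclideanSpace ℝ (Fin d)) (WithLp.toLp 2 v) := by
  rw [segLength, EuclideanSpace.dist_eq]
  congr 1
  refine Finset.sum_congr rfl fun j _ => ?_
  rw [PiLp.toLp_apply, PiLp.toLp_apply, Real.dist_eq, sq_abs]

/-- Symmetry of the segment length. [cite: BenfattoEtAl1978, after (4.1) p.151] -/
theorem segLength_comm (u v : Fin d → ℝ) : segLength u v = segLength v u := by
  rw [segLength_eq_dist, segLength_eq_dist, dist_comm]

/-- The segment length is non-negative. [cite: BenfattoEtAl1978, after (4.1) p.151] -/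
theorem segLength_nonneg (u v : Fin d → ℝ) : 0 ≤ segLength u v := by
  rw [segLength_eq_dist]
  exact dist_nonneg

/-- A degenerate segment has length `0`. [cite: BenfattoEtAl1978, after (4.1) p.151] -/
theorem segLength_self (u : Fin d → ℝ) : segLength u u = 0 := by
  rw [segLength_eq_dist, dist_self]

/-- **Triangle inequality for segments.** [cite: BenfattoEtAl1978, after (4.1) p.151] -/
theorem segLength_triangle (u v w : Fin d → ℝ) : segLength u w ≤ segLength u v + segLength v w := by
  simp only [segLength_eq_dist]
  exact dist_triangle _ _ _

/-! ## §2  Polygonal paths: peeling a segment, and «two vertices are no farther apart than the path is long» -/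

/-- A polygon with no vertex has length `0`. [cite: BenfattoEtAl1978, after (4.1) p.151] -/
theorem polyLength_zero' (y : Fin 0 → (Fin d → ℝ)) : polyLength y = 0 := by
  simp [polyLength]

/-- A polygon with one vertex has length `0`. [cite: BenfattoEtAl1978, after (4.1) p.151] -/
theorem polyLength_one' (y : Fin 1 → (Fin d → ℝ)) : polyLength y = 0 := by
  simp [polyLength, List.ofFn_succ]

/-- **Peeling the first segment**: `polyLength (y₀, y₁, y₂, …) = |y₀ − y₁| + polyLength (y₁, y₂, …)`.
[cite: BenfattoEtAl1978, after (4.1) p.151] -/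
theorem polyLength_succ_succ {p : ℕ} (y : Fin (p + 2) → (Fin d → ℝ)) :
    polyLength y = segLength (y 0) (y 1) + polyLength (fun i : Fin (p + 1) => y i.succ) := by
  simp only [polyLength]
  rw [List.ofFn_succ (f := y), List.ofFn_succ (f := fun i : Fin (p + 1) => y i.succ)]
  simp only [List.tail_cons, List.zip_cons_cons, List.map_cons, List.sum_cons]
  rfl

/-- The length of a polygonal path is non-negative. [cite: BenfattoEtAl1978, after (4.1) p.151] -/
theorem polyLength_nonneg : ∀ {p : ℕ} (y : Fin p → (Fin d → ℝ)), 0 ≤ polyLength y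
  | 0, y => by rw [polyLength_zero']
  | 1, y => by rw [polyLength_one']
  | p + 2, y => by
      rw [polyLength_succ_succ]
      exact add_nonneg (segLength_nonneg _ _) (polyLength_nonneg _)

/-- The first vertex is within the path length of every vertex. [cite: BenfattoEtAl1978, after (4.1) p.151] -/
theorem segLength_zero_le_polyLength : ∀ {p : ℕ} (y : Fin (p + 1) → (Fin d → ℝ)) (j : Fin (p + 1)),
    segLength (y 0) (y j) ≤ polyLength y
  | 0, y, j => by
      rw [Fin.eq_zero j, segLength_self, polyLength_one']
  | p + 1, y, j => by
      rw [polyLength_succ_succ]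
      by_cases hj : j = 0
      · rw [hj, segLength_self]
        exact add_nonneg (segLength_nonneg _ _) (polyLength_nonneg _)
      · obtain ⟨j', rfl⟩ := Fin.exists_succ_eq.mpr hj
        have ih := segLength_zero_le_polyLength (fun i : Fin (p + 1) => y i.succ) j'
        have htri := segLength_triangle (y 0) (y 1) (y j'.succ)
        have h1 : (fun i : Fin (p + 1) => y i.succ) 0 = y 1 := rfl
        simp only [h1] at ih
        linarith

/-- **Any two vertices of a polygonal path are no farther apart than its length.** [cite: BenfattoEtAl1978, after (4.1) p.151] -/
theorem segLength_le_polyLength : ∀ {p : ℕ} (y : Fin p → (Fin d → ℝ)) (i j : Fin p), segLength (y i) (y j) ≤ polyLength y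
  | 0, _, i, _ => i.elim0
  | 1, y, i, j => by
      rw [Fin.eq_zero i, Fin.eq_zero j, segLength_self]
      exact polyLength_nonneg _
  | p + 2, y, i, j => by
      by_cases hi : i = 0
      · subst hi
        exact segLength_zero_le_polyLength y j
      by_cases hj : j = 0
      · subst hj
        rw [segLength_comm]
        exact segLength_zero_le_polyLength y i
      obtain ⟨i', rfl⟩ := Fin.exists_succ_eq.mpr hi
      obtain ⟨j', rfl⟩ := Fin.exists_succ_eq.mpr hj
      have ih := segLength_le_polyLength (fun k : Fin (p + 1) => y k.succ) i' j'
      rw [polyLength_succ_succ]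
      linarith [segLength_nonneg (y 0) (y 1)]

/-! ## §3  `cubeDist` is the distance of the closed unit cubes -/

/-- Coordinatewise: for `s ∈ [x_j, x_j + 1]` and `t ∈ [y_j, y_j + 1]`, `max(|x_j − y_j| − 1, 0) ≤ |s − t|`.
[cite: BenfattoEtAl1978, after (2.3) p.146] -/
theorem abs_sub_sub_one_le_of_mem_interval {a b s t : ℝ} (hs : a ≤ s ∧ s ≤ a + 1) (ht : b ≤ t ∧ t ≤ b + 1) :
    max (|a - b| - 1) 0 ≤ |s - t| := by
  refine max_le ?_ (abs_nonneg _)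
  rcases le_total a b with hab | hab
  · rw [abs_of_nonpos (by linarith : a - b ≤ 0)]
    have : b - a - 1 ≤ |s - t| := by
      rcases le_total s t with hst | hst
      · rw [abs_of_nonpos (by linarith : s - t ≤ 0)]; linarith
      · rw [abs_of_nonneg (by linarith : 0 ≤ s - t)]; linarith
    linarith
  · rw [abs_of_nonneg (by linarith : 0 ≤ a - b)]
    rcases le_total s t with hst | hst
    · rw [abs_of_nonpos (by linarith : s - t ≤ 0)]; linarith
    · rw [abs_of_nonneg (by linarith : 0 ≤ s - t)]; linarith

/-- **Points of `Δ_x` and `Δ_y` are at least `cubeDist x y` apart** («the distance between the sets Δ and I»: `cubeDist` is the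
Euclidean distance of the closed unit cubes). [cite: BenfattoEtAl1978, after (2.3) p.146] -/
theorem cubeDist_le_segLength {x y : B1Eq324BenfattoLemma.Site d} {u v : Fin d → ℝ} (hu : u ∈ unitCube x) (hv : v ∈ unitCube y) :
    cubeDist x y ≤ segLength u v := by
  rw [cubeDist, segLength]
  refine Real.sqrt_le_sqrt (Finset.sum_le_sum fun j _ => ?_)
  have h := abs_sub_sub_one_le_of_mem_interval (hu j) (hv j)
  have h0 : 0 ≤ max (|((x j : ℝ) - (y j : ℝ))| - 1) 0 := le_max_right _ _
  calc max (|((x j : ℝ) - (y j : ℝ))| - 1) 0 ^ 2 ≤ |u j - v j| ^ 2 := pow_le_pow_left₀ h0 h 2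
    _ = (u j - v j) ^ 2 := sq_abs _

/-- `cubeDist` is symmetric. [cite: BenfattoEtAl1978, after (2.3) p.146] -/
theorem cubeDist_comm (x y : B1Eq324BenfattoLemma.Site d) : cubeDist x y = cubeDist y x := by
  rw [cubeDist, cubeDist]
  congr 1
  refine Finset.sum_congr rfl fun j _ => ?_
  rw [abs_sub_comm]

/-- The lattice corner of `Δ_x` lies in `Δ_x`. [cite: BenfattoEtAl1978, §1 p.144] -/
theorem corner_mem_unitCube (x : B1Eq324BenfattoLemma.Site d) : (fun j => (x j : ℝ)) ∈ unitCube x :=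
  fun j => ⟨le_rfl, by linarith⟩

/-! ## §4  `connLength`: non-negativity and «the connecting path passes through every cube» -/

/-- The set of admissible path lengths in the definition of `connLength`. [cite: BenfattoEtAl1978, after (4.1) p.151] -/
private theorem connSet_nonempty {p : ℕ} (Δ : Fin p → B1Eq324BenfattoLemma.Site d) :
    {ℓ : ℝ | ∃ σ : Equiv.Perm (Fin p), ∃ y : Fin p → (Fin d → ℝ),
      (∀ i, y i ∈ unitCube (Δ (σ i))) ∧ ℓ = polyLength y}.Nonempty :=
  ⟨polyLength fun i j => (Δ i j : ℝ), 1, fun i j => (Δ i j : ℝ), fun i => by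
    simpa using corner_mem_unitCube (Δ i), rfl⟩

/-- kernel: every admissible length is non-negative. [folklore] -/
private theorem connSet_nonneg {p : ℕ} (Δ : Fin p → B1Eq324BenfattoLemma.Site d) :
    ∀ ℓ ∈ {ℓ : ℝ | ∃ σ : Equiv.Perm (Fin p), ∃ y : Fin p → (Fin d → ℝ),
      (∀ i, y i ∈ unitCube (Δ (σ i))) ∧ ℓ = polyLength y}, 0 ≤ ℓ := by
  rintro ℓ ⟨σ, y, -, rfl⟩
  exact polyLength_nonneg y

/-- **`d(Δ₁, …, Δ_p) ≥ 0`.** [cite: BenfattoEtAl1978, after (4.1) p.151] -/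
theorem connLength_nonneg {p : ℕ} (Δ : Fin p → B1Eq324BenfattoLemma.Site d) : 0 ≤ connLength Δ :=
  le_csInf (connSet_nonempty Δ) (connSet_nonneg Δ)

/-- **THE CONNECTING PATH PASSES THROUGH EVERY CUBE: `cubeDist (Δ a) (Δ b) ≤ d(Δ₁, …, Δ_p)`** for all indices `a, b` — a polygon with a
vertex in each cube, in any visiting order, joins a point of `Δ_a` to a point of `Δ_b`, and those are `≥ cubeDist` apart.  The source of
every «tuples reaching across a corridor of width ℓ have d ≥ ℓ» in §5. [cite: BenfattoEtAl1978, after (4.1) p.151; (5.11) p.155] -/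
theorem cubeDist_le_connLength {p : ℕ} (Δ : Fin p → B1Eq324BenfattoLemma.Site d) (a b : Fin p) : cubeDist (Δ a) (Δ b) ≤ connLength Δ := by
  refine le_csInf (connSet_nonempty Δ) ?_
  rintro ℓ ⟨σ, y, hy, rfl⟩
  have ha : y (σ.symm a) ∈ unitCube (Δ a) := by simpa using hy (σ.symm a)
  have hb : y (σ.symm b) ∈ unitCube (Δ b) := by simpa using hy (σ.symm b)
  exact (cubeDist_le_segLength ha hb).trans (segLength_le_polyLength y _ _)

/-- **The decay factor of a tuple is dominated by two-body decays from any anchor**: for `c ≥ 0` and `p ≥ 1` cubes,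
`e^{−c·d(Δ)} ≤ Π_{i} e^{−(c/p)·cubeDist(Δ a, Δ i)}` (each `cubeDist(Δ a, Δ i) ≤ d(Δ)`, so their mean is `≤ d(Δ)`).
[cite: BenfattoEtAl1978, (5.11) p.155] -/
theorem exp_neg_mul_connLength_le_prod {p : ℕ} (Δ : Fin p → B1Eq324BenfattoLemma.Site d) (a : Fin p) {c : ℝ} (hc : 0 ≤ c) :
    Real.exp (-(c * connLength Δ)) ≤ ∏ i : Fin p, Real.exp (-(c / p * cubeDist (Δ a) (Δ i))) := by
  have hp : 0 < p := Fin.pos a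
  rw [← Real.exp_sum, Real.exp_le_exp, Finset.sum_neg_distrib, neg_le_neg_iff]
  have hsum : ∑ i : Fin p, c / p * cubeDist (Δ a) (Δ i) ≤ ∑ _i : Fin p, c / p * connLength Δ :=
    Finset.sum_le_sum fun i _ => mul_le_mul_of_nonneg_left (cubeDist_le_connLength Δ a i) (div_nonneg hc (Nat.cast_nonneg p))
  rw [Finset.sum_const, Finset.card_univ, Fintype.card_fin, nsmul_eq_mul] at hsum
  have hp' : (p : ℝ) ≠ 0 := by exact_mod_cast hp.ne'
  have : (p : ℝ) * (c / p * connLength Δ) = c * connLength Δ := by field_simp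
  rw [this] at hsum
  exact hsum

/-! ## §5  Lattice sums of `e^{−c·cubeDist}`, uniformly in the region -/

/-- kernel — **1-d geometric sum over any finite set of integers**: `Σ_{n∈S} r^{|n|} ≤ 2/(1 − r)` for `0 ≤ r < 1` (the non-negative
and the negative part of `S` each inject into `ℕ` under `|·|`). [folklore] -/
private theorem sum_pow_natAbs_le (S : Finset ℤ) {r : ℝ} (h0 : 0 ≤ r) (h1 : r < 1) :
    ∑ n ∈ S, r ^ n.natAbs ≤ 2 / (1 - r) := by
  -- split into non-negative and negative parts; each injects into ℕ by `natAbs`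
  have key : ∀ T : Finset ℤ, Set.InjOn Int.natAbs (T : Set ℤ) → ∑ n ∈ T, r ^ n.natAbs ≤ 1 / (1 - r) := by
    intro T hT
    rw [← Finset.sum_image (f := fun k : ℕ => r ^ k) hT]
    have hs : Summable fun k : ℕ => r ^ k := summable_geometric_of_lt_one h0 h1
    calc ∑ k ∈ T.image Int.natAbs, r ^ k ≤ ∑' k : ℕ, r ^ k :=
          hs.sum_le_tsum _ fun k _ => pow_nonneg h0 k
      _ = 1 / (1 - r) := by rw [tsum_geometric_of_lt_one h0 h1, one_div]
  classical
  set Sp := S.filter fun n => 0 ≤ n with hSp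
  set Sn := S.filter fun n => n < 0 with hSn
  have hsplit : ∑ n ∈ S, r ^ n.natAbs = ∑ n ∈ Sp, r ^ n.natAbs + ∑ n ∈ Sn, r ^ n.natAbs := by
    rw [← Finset.sum_filter_add_sum_filter_not S (fun n => 0 ≤ n)]
    congr 1
    refine Finset.sum_congr ?_ fun _ _ => rfl
    ext n
    simp only [Finset.mem_filter, not_le, hSn]
  have hp : Set.InjOn Int.natAbs (Sp : Set ℤ) := by
    intro m hm n hn hmn
    simp only [Finset.coe_filter, Set.mem_setOf_eq, hSp] at hm hn
    have := Int.natAbs_inj_of_nonneg_of_nonneg hm.2 hn.2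
    exact this.mp hmn
  have hn : Set.InjOn Int.natAbs (Sn : Set ℤ) := by
    intro m hm n hn hmn
    simp only [Finset.coe_filter, Set.mem_setOf_eq, hSn] at hm hn
    have := Int.natAbs_inj_of_nonpos_of_nonpos hm.2.le hn.2.le
    exact this.mp hmn
  rw [hsplit]
  have h2 : 2 / (1 - r) = 1 / (1 - r) + 1 / (1 - r) := by ring
  rw [h2]
  exact add_le_add (key Sp hp) (key Sn hn)

/-- **The gap vector's Euclidean norm dominates its ℓ¹ norm over `√d`**: `Σ_j max(|x_j − y_j| − 1, 0) ≤ √d · cubeDist x y`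
(Cauchy–Schwarz). [cite: BenfattoEtAl1978, after (2.3) p.146] -/
theorem sum_gap_le_sqrt_mul_cubeDist (x y : B1Eq324BenfattoLemma.Site d) :
    ∑ j, max (|((x j : ℝ) - (y j : ℝ))| - 1) 0 ≤ Real.sqrt d * cubeDist x y := by
  set g : Fin d → ℝ := fun j => max (|((x j : ℝ) - (y j : ℝ))| - 1) 0 with hg
  have hg0 : ∀ j, 0 ≤ g j := fun j => le_max_right _ _
  have hsum0 : 0 ≤ ∑ j, g j := Finset.sum_nonneg fun j _ => hg0 j
  have hcs : (∑ j, g j) ^ 2 ≤ (Finset.univ : Finset (Fin d)).card * ∑ j, g j ^ 2 := sq_sum_le_card_mul_sum_sq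
  rw [Finset.card_univ, Fintype.card_fin] at hcs
  have hcube : cubeDist x y = Real.sqrt (∑ j, g j ^ 2) := rfl
  rw [hcube, ← Real.sqrt_mul (Nat.cast_nonneg d), ← Real.sqrt_sq hsum0]
  exact Real.sqrt_le_sqrt hcs

/-- **LATTICE SUMS OF THE DECAY FACTOR, UNIFORMLY IN THE REGION**: for `c > 0`, every finite `F ⊂ ℤ^d` and every `x`,
`Σ_{y∈F} e^{−c·cubeDist x y} ≤ (2/(1 − e^{−c/√d}) · e^{c/√d})^d` — `e^{−c·cubeDist} ≤ Π_j e^{−(c/√d)·max(|x_j−y_j|−1,0)}`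
(previous lemma), the sum over `F` is at most the sum over the product of its coordinate projections, which factorizes into 1-d
geometric sums (`sum_pow_natAbs_le`, with `max(|n|−1, 0) ≥ |n| − 1`).  This is the «|I|»-extensivity mechanism of (5.11): summing a
decaying tuple weight over all positions costs a constant per anchor. [cite: BenfattoEtAl1978, (5.11) p.155] -/
theorem sum_exp_neg_mul_cubeDist_le {c : ℝ} (hc : 0 < c) (F : Finset (B1Eq324BenfattoLemma.Site d)) (x : B1Eq324BenfattoLemma.Site d) :
    ∑ y ∈ F, Real.exp (-(c * cubeDist x y)) ≤
      (2 / (1 - Real.exp (-(c / Real.sqrt d))) * Real.exp (c / Real.sqrt d)) ^ d := by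
  classical
  -- the 1-d ratio
  set c' : ℝ := c / Real.sqrt d with hc'
  set r : ℝ := Real.exp (-c') with hr
  have hc'0 : 0 ≤ c' := div_nonneg hc.le (Real.sqrt_nonneg _)
  have hr0 : 0 < r := Real.exp_pos _
  have hr1 : r ≤ 1 := by rw [hr]; exact Real.exp_le_one_iff.mpr (by linarith)
  -- Step 1: pointwise domination by the product of 1-d factors `r^{max(|x_j − y_j| − 1, 0)} ≤ r^{|x_j − y_j|} / r = r^{natAbs}·e^{c'}`
  have hpt : ∀ y : B1Eq324BenfattoLemma.Site d, Real.exp (-(c * cubeDist x y)) ≤ ∏ j, (r ^ (x j - y j).natAbs * Real.exp c') := by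
    intro y
    have h1 : Real.exp (-(c * cubeDist x y)) ≤ Real.exp (-(c' * ∑ j, max (|((x j : ℝ) - (y j : ℝ))| - 1) 0)) := by
      rw [Real.exp_le_exp, neg_le_neg_iff]
      by_cases hd : d = 0
      · subst hd
        simp only [Finset.univ_eq_empty, Finset.sum_empty, mul_zero]
        exact mul_nonneg hc.le (Real.sqrt_nonneg _)
      have hsd : 0 < Real.sqrt d := Real.sqrt_pos.mpr (by exact_mod_cast Nat.pos_of_ne_zero hd)
      have h := sum_gap_le_sqrt_mul_cubeDist x y
      calc c' * ∑ j, max (|((x j : ℝ) - (y j : ℝ))| - 1) 0 ≤ c' * (Real.sqrt d * cubeDist x y) :=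
            mul_le_mul_of_nonneg_left h hc'0
        _ = c * cubeDist x y := by rw [hc']; field_simp
    refine h1.trans ?_
    have hexp : Real.exp (-(c' * ∑ j, max (|((x j : ℝ) - (y j : ℝ))| - 1) 0)) =
        ∏ j, Real.exp (-(c' * max (|((x j : ℝ) - (y j : ℝ))| - 1) 0)) := by
      rw [← Real.exp_sum, Finset.mul_sum, ← Finset.sum_neg_distrib]
    rw [hexp]
    refine Finset.prod_le_prod (fun j _ => (Real.exp_pos _).le) fun j _ => ?_
    -- exp(−c'·max(|x_j−y_j|−1,0)) ≤ r^{natAbs (x_j − y_j)} · e^{c'}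
    have hgap : ((x j - y j).natAbs : ℝ) - 1 ≤ max (|((x j : ℝ) - (y j : ℝ))| - 1) 0 := by
      have : ((x j - y j).natAbs : ℝ) = |((x j : ℝ) - (y j : ℝ))| := by
        rw [Nat.cast_natAbs, Int.cast_abs, Int.cast_sub]
      rw [this]
      exact le_max_left _ _
    have h2 : Real.exp (-(c' * max (|((x j : ℝ) - (y j : ℝ))| - 1) 0)) ≤ Real.exp (-(c' * (((x j - y j).natAbs : ℝ) - 1))) := by
      rw [Real.exp_le_exp, neg_le_neg_iff]
      exact mul_le_mul_of_nonneg_left hgap hc'0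
    refine h2.trans (le_of_eq ?_)
    rw [hr, ← Real.exp_nat_mul, ← Real.exp_add]
    congr 1
    ring
  -- Step 2: sum over F ≤ sum over the product of the coordinate projections, which factorizes
  set P : Finset (B1Eq324BenfattoLemma.Site d) := Fintype.piFinset fun j => F.image fun y : B1Eq324BenfattoLemma.Site d => y j with hP
  have hFP : F ⊆ P := by
    intro y hy
    rw [hP, Fintype.mem_piFinset]
    exact fun j => Finset.mem_image_of_mem _ hy
  have hnn : ∀ y ∈ P, 0 ≤ ∏ j, (r ^ (x j - y j).natAbs * Real.exp c') :=
    fun y _ => Finset.prod_nonneg fun j _ => mul_nonneg (pow_nonneg hr0.le _) (Real.exp_pos _).le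
  calc ∑ y ∈ F, Real.exp (-(c * cubeDist x y)) ≤ ∑ y ∈ F, ∏ j, (r ^ (x j - y j).natAbs * Real.exp c') :=
        Finset.sum_le_sum fun y _ => hpt y
    _ ≤ ∑ y ∈ P, ∏ j, (r ^ (x j - y j).natAbs * Real.exp c') :=
        Finset.sum_le_sum_of_subset_of_nonneg hFP fun y hy _ => hnn y hy
    _ = ∏ j, ∑ n ∈ F.image (fun y : B1Eq324BenfattoLemma.Site d => y j), (r ^ (x j - n).natAbs * Real.exp c') := by
        rw [hP]
        exact (Finset.prod_univ_sum (fun j => F.image fun y : B1Eq324BenfattoLemma.Site d => y j)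
          (fun j n => r ^ (x j - n).natAbs * Real.exp c')).symm
    _ ≤ ∏ _j : Fin d, (2 / (1 - r) * Real.exp c') := by
        refine Finset.prod_le_prod (fun j _ => Finset.sum_nonneg fun n _ =>
          mul_nonneg (pow_nonneg hr0.le _) (Real.exp_pos _).le) fun j _ => ?_
        rw [← Finset.sum_mul]
        refine mul_le_mul_of_nonneg_right ?_ (Real.exp_pos _).le
        -- reindex n ↦ x j − n (injective) and apply the 1-d geometric bound
        have hinj : Set.InjOn (fun n : ℤ => x j - n) ((F.image fun y : B1Eq324BenfattoLemma.Site d => y j) : Set ℤ) :=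
          fun m _ n _ h => by simpa using h
        rw [← Finset.sum_image (f := fun m : ℤ => r ^ m.natAbs) hinj]
        by_cases hr1' : r < 1
        · exact sum_pow_natAbs_le _ hr0.le hr1'
        · -- r = 1 means c' = 0, i.e. d = 0: then there is no coordinate j at all
          exfalso
          have hr_eq : r = 1 := le_antisymm hr1 (not_lt.mp hr1')
          have hc'z : c' = 0 := by
            have h0 : -c' = 0 := Real.exp_injective (by rw [Real.exp_zero]; exact hr_eq)
            linarith
          have hd : Real.sqrt d ≠ 0 := by
            intro h0
            have : (d : ℝ) = 0 := by
              have := Real.sqrt_eq_zero'.mp h0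
              exact le_antisymm this (Nat.cast_nonneg d)
            have hd0 : d = 0 := by exact_mod_cast this
            subst hd0
            exact j.elim0
          rw [hc', div_eq_zero_iff] at hc'z
          rcases hc'z with h | h
          · exact hc.ne' h
          · exact hd h
    _ = (2 / (1 - r) * Real.exp c') ^ d := by
        rw [Finset.prod_const, Finset.card_univ, Fintype.card_fin]

end Literature.MathematicalPhysics.QuantumFieldTheory.Balaban1983to89.B1Eq324BenfattoConnLength

end
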